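import Summits.QuantumAdvantage.QuantumAdvantage.Theorems.PromiseLiftPlLiftStubCertifyK8
import Summits.QuantumAdvantage.QuantumAdvantage.Theorems.WhiteBoxWalkWbwThesis
import Literature.Computability.QuantumComplexity.FBQPOracleAccess

/-!
# Crux `PlLift` (stmt-QuantumAdvantage-0250), line `certified-canonical-lift` — stub
`stub_certified_of_factoring : FactoringAssumption → WbwCertifiedThesis`

The S-half `stub_certified_thesis : WbwCertifiedThesis` of the line skeleton
`Cruxes/PlLift/Lines/certified_canonical_lift.lean` (sha `f97c9d33e600`) is hypothesis-grade: with the two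
LANDED stubs `stub_certify` (`Theorems/PromiseLiftPlLiftStubCertifyK8.lean`) and `stub_canonical_lift`
(`Theorems/PromiseLiftPlLiftStubCanonicalLiftSiegeK3.lean`) it implies the summit `QuantumAdvantage`, so no
unconditional proof is expected. Following the stub plan (`Cruxes/PlLift/STUB-PLAN-stub_certified_thesis.md`,
Step 1) this file lands its CONDITIONAL closure at the registered conjecture leaf of the sibling crux
`WbwThesis`: the average-case factoring assumption (`Theorems/FactoringAssumption.lean`, Goldreich 2001
§2.2.4.1, `@[conjecture]`, never asserted here) implies certified planting,

  `stub_certified_of_factoring : FactoringAssumption → WbwCertifiedThesis`,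

re-using the landed factoring line of `Theorems/WhiteBoxWalkWbwThesis*.lean` (`genPQ`, `ansPQ`, `prePQ`,
`isOneWay_genPQ`, `stub_extract`, `stub_assemble`, `stub_canon`, the truncation adversary of `stub_bridge`)
and Shor's theorem in `FBQP` form (`factoring_mem_FBQP_holds`).

## The proof (plumbing over proved tree facts; the only hypothesis is the named conjecture)

* (H1) At the typed level the certificate slot is free: `WbwCanonicalThesis → WbwCertifiedThesis` with the
  trivial verifier `V ≡ true`.
* (H2) Clause (C) from one-wayness of `gen` plus a length-preserving preimage map `pre`
  (`gen (pre s) = gen s`, `|pre s| = |s|`): a PPT printing `pre s ++ 0…0` on `⟨1ⁿ, gen s⟩` truncates to a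
  PPT inverter of `gen` (`Bridge.isPPT_of_run_eq_take`, `Bridge.run_eq_of_prefix`) — the (C) bullet of
  `stub_bridge`, stated on its own.
* (H3) The self-delimiting factor-list code has an `FP` canonicaliser `canonLFn ∘ sndF` reading the code
  prefix of `y` whatever follows it.
* (H4) GENERIC everywhere-canonicity of a planted `FBQP` function: if `f ∈ FBQP` has an `FP` canonicaliser of
  its output prefix, then for `FP` maps `pre`, `post` the total map
  `x ↦ (post ⟨x, f (pre x)⟩ ++ 0^{p|x|}) ↾ p|x|` is written first with probability `≥ 2/3` on EVERY input
  by one uniform oracle-free Clifford+T family (`isQSolvable_classicalWrap_dep` + monotonicity).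
* (H5) The everywhere-canonical answer map of the factoring witness:
  `a x := (g ⟨x, factorCode ⟦h x⟧⟩ ++ 0^{|x|}) ↾ |x|` with `h`, `g` the programs of `stub_extract` /
  `stub_assemble`; `a (genPQ w) = ansPQ w`, `|a x| = |x|`, solved everywhere by (H4) at `p := X`.
* (H6) Assembly: `gen := genPQ`, `ans := ansPQ`, `p := X`, (H5), and (C) by (H2) with `pre := prePQ`
  (`stub_canon`), then (H1).

Scope honesty (plan §K4): the closure `FactoringAssumption ⊢ WbwCertifiedThesis ⊢ … ⊢ PlLift` is benchmark /
calibration content, Shor-redundant by design (route WhiteBoxWalk's kill criterion (c) is not triggered by an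
"also"); the Shor-neutral content of the line is its ENGINE (card §Engine), not this stub.

References: O. Goldreich, *Foundations of Cryptography I* (2001), Def. 2.2.1, §2.2.4.1, Thm. 2.3.2;
P. Shor, SIAM J. Comput. 26 (1997) §5; E. Bernstein, U. Vazirani, SIAM J. Comput. 26 (1997) §8;
S. Arora, B. Barak, *Computational Complexity* (2009), §0.1 / §1.3 (self-delimiting codes).
-/

noncomputable section

-- `Summit.<Summit>.<Problem>` is the mandated summit-side prefix; single-conjunct summit ⇒ `QuantumAdvantage.QuantumAdvantage`.
set_option linter.dupNamespace false

namespace Summit.QuantumAdvantage.QuantumAdvantage.Cruxes.PlLift.CertifiedCanonicalLift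

open Filter Asymptotics _root_.Computability Polynomial
open Literature.Computability.Complexity Literature.Computability.Cryptography
open Literature.Computability.Complexity.Brick (fstF sndF fstF_boolPair sndF_boolPair fstF_mem_FP sndF_mem_FP)
open Literature.Computability.Complexity.Plumb (takeFn takeFn_boolPair takeFn_mem_FP polyFn polyFn_apply polyFn_mem_FP)
open Literature.Computability.Complexity.Knapsack (canonLFn canonLFn_eq canonLFn_mem_FP)
open Literature.Computability.Complexity.OracleCompose (concatFn concatFn_boolPair concatFn_mem_FP)
open Literature.Computability.QuantumComplexity (isQSolvable_classicalWrap_dep)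
open Summit.QuantumAdvantage.QuantumAdvantage.Theorems (FactoringAssumption)
open Summit.QuantumAdvantage.QuantumAdvantage.Theorems.WhiteBoxWalk

namespace OfFactoring

/-! ### Width pinning `w ↦ (w ++ 0^ℓ) ↾ ℓ` and its `FP` brick -/

/-- Zero-padding then cutting to width `ℓ` yields a word of length exactly `ℓ`. [folklore] -/
theorem length_take_append_replicate (ℓ : ℕ) (w : List Bool) :
    ((w ++ List.replicate ℓ false).take ℓ).length = ℓ := by
  simp

/-- On a word of length `ℓ` the width pinning is the identity. [folklore] -/
theorem take_append_replicate_of_length_eq {ℓ : ℕ} {w : List Bool} (h : w.length = ℓ) :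
    (w ++ List.replicate ℓ false).take ℓ = w := by
  simp [← h]

/-- The width-pinning brick `⟨x, w⟩ ↦ (w ++ 0^{p|x|}) ↾ p|x|` (bricks `Plumb.takeFn`, `Plumb.polyFn`,
`OracleCompose.concatFn`, `Kannan.zerosFn`) is polynomial-time. [cite: AroraBarakCC2009, §1.3] -/
theorem padCutFn_mem_FP (p : Polynomial ℕ) :
    (takeFn ∘ fanoutFn (polyFn p ∘ fstF) (concatFn ∘ fanoutFn sndF (Kannan.zerosFn ∘ polyFn p ∘ fstF))) ∈ FP :=
  comp_mem_FP takeFn_mem_FP (fanoutFn_mem_FP (comp_mem_FP (polyFn_mem_FP p) fstF_mem_FP)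
    (comp_mem_FP concatFn_mem_FP (fanoutFn_mem_FP sndF_mem_FP
      (comp_mem_FP Kannan.zerosFn_mem_FP (comp_mem_FP (polyFn_mem_FP p) fstF_mem_FP)))))

/-! ### (H1) The certificate slot is free at the typed level -/

/-- **(H1) `X_pd → X_cert`** with the trivial verifier `V ≡ true` (`const_mem_FP [true]`): an
everywhere-canonical planted solver is in particular canonical on the everywhere-accepting certified set.
[folklore] -/
theorem certified_of_canonical : WbwCanonicalThesis → WbwCertifiedThesis := by
  rintro ⟨gen, ans, a, p, hgen, hag, hlen, ⟨F, hF, hU, hQ⟩, hC⟩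
  exact ⟨gen, ans, a, fun _ => true, p, hgen, const_mem_FP [true], fun _ => rfl, hag, hlen,
    ⟨F, hF, hU, fun x _ => hQ x⟩, hC⟩

/-! ### (H2) Clause (C) from one-wayness and a canonical preimage -/

/-- **(H2) Classical hardness from one-wayness.** If `gen` is one-way and `pre s` is a `gen`-preimage of
`gen s` of the seed's length, then no PPT prints `pre s ++ 0^{|gen s| - |s|}` on `⟨1ⁿ, gen s⟩` with
non-negligible probability over a uniform seed: the truncation adversary "first `n` output symbols"
(`Bridge.isPPT_of_run_eq_take`) is a PPT inverter whose inversion probability dominates the printing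
probability seed by seed and coin string by coin string (`Bridge.run_eq_of_prefix`). The (C) bullet of
`stub_bridge`, stated on its own. [cite: Goldreich2001, Def. 2.2.1] -/
theorem clauseC_of_isOneWay {gen pre : List Bool → List Bool} (hgen : IsOneWay gen)
    (hpre : ∀ s, gen (pre s) = gen s) (hlen : ∀ s, (pre s).length = s.length) :
    ∀ A : RandAlg (List Bool) (List Bool), IsPPT A id →
      SuperpolynomialDecay atTop (fun n : ℕ => (n : ℝ)) fun n : ℕ =>
        uniformAvg n fun s => A.pr id (boolPair (unaryEncodeNat n) (gen s))
          {y | pre s ++ List.replicate ((gen s).length - s.length) false <+: y} := by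
  intro A hA
  obtain ⟨B, hrun, hcoin⟩ : ∃ B : RandAlg (List Bool) (List Bool),
      (∀ z r, B.run z r = (A.run z r).take (fstF z).length) ∧ B.coinLen = A.coinLen :=
    ⟨⟨fun z r => (A.run z r).take (fstF z).length, A.coinLen⟩, fun _ _ => rfl, rfl⟩
  refine (hgen.2 B (Bridge.isPPT_of_run_eq_take hA hrun hcoin)).trans_abs_le fun n => ?_
  rw [abs_of_nonneg (invertProb_nonneg _ _ _),
    abs_of_nonneg (uniformAvg_nonneg fun _ => RandAlg.pr_nonneg _ _ _ _)]
  unfold invertProb uniformAvg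
  refine div_le_div_of_nonneg_right (Finset.sum_le_sum fun x _ => ?_) (by positivity)
  classical
  dsimp only
  rw [RandAlg.pr_eq_uniformProb, RandAlg.pr_eq_uniformProb, hcoin]
  unfold uniformProb
  refine div_le_div_of_nonneg_right ?_ (by positivity)
  exact_mod_cast Finset.card_le_card fun r hr => by
    simp only [Finset.mem_filter, Finset.mem_univ, true_and, Set.mem_setOf_eq] at hr ⊢
    have hu : (unaryEncodeNat n).length = (pre x.toList).length := by
      rw [hlen, x.toList_length]
      exact unary_decode_encode_nat n
    rw [Bridge.run_eq_of_prefix hrun hu hr, hpre]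

/-! ### (H3) The factor-list code has an `FP` canonicaliser -/

/-- **(H3)** `pick := canonLFn ∘ sndF` re-encodes the self-delimited list-code prefix of `y`, whatever the
junk after it: `factorCode ⟦u⟧ <+: y → pick ⟨u, y⟩ = factorCode ⟦u⟧` (`canonLFn_eq`,
`Knapsack.decode_natList`, `listBool_decode_encode_append`). [cite: AroraBarakCC2009, §0.1] -/
theorem factorCode_pick : ∃ pick : List Bool → List Bool, pick ∈ FP ∧
    ∀ u y : List Bool, factorCode (decodeNat u) <+: y → pick (boolPair u y) = factorCode (decodeNat u) := by
  refine ⟨canonLFn ∘ sndF, comp_mem_FP canonLFn_mem_FP sndF_mem_FP, fun u y hy => ?_⟩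
  obtain ⟨t, rfl⟩ := hy
  rw [Function.comp_apply, sndF_boolPair, canonLFn_eq]
  unfold factorCode
  congr 1
  have h1 := Literature.Computability.Complexity.Knapsack.decode_natList
    (encodingListNatBool.encode (decodeNat u).primeFactorsList ++ t)
  rw [Literature.Computability.Cryptography.listBool_decode_encode_append] at h1
  exact (Option.some.inj h1).symm

/-! ### (H4) Generic everywhere-canonicity of a planted `FBQP` function -/

/-- **(H4) Everywhere-canonicity of a planted `FBQP` function.** An `FBQP` function `f` with an `FP`
canonicaliser `pick` of its output prefix, planted through `FP` pre/post-processing and cut to exact width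
`p |x|`, is written FIRST with probability `≥ 2/3` on EVERY input by one uniform oracle-free Clifford+T
family: `isQSolvable_classicalWrap_dep pre G` with
`G ⟨x, y⟩ := (post ⟨x, pick ⟨pre x, y⟩⟩ ++ 0^{p|x|}) ↾ p|x|`, then monotonicity of the solved event
(`hread` makes `G` canonical on the `≥ 2/3` event `{y | f (pre x) <+: y}`).
[cite: BernsteinVazirani1997, §8] -/
theorem everywhereQ_of_mem_FBQP {f pre post pick : List Bool → List Bool} (p : Polynomial ℕ)
    (hf : f ∈ FBQP) (hpre : pre ∈ FP) (hpost : post ∈ FP) (hpick : pick ∈ FP)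
    (hread : ∀ u y, f u <+: y → pick (boolPair u y) = f u) :
    IsQSolvable fun x =>
      {y | (post (boolPair x (f (pre x))) ++ List.replicate (p.eval x.length) false).take (p.eval x.length)
        <+: y} := by
  obtain ⟨F, hFfree, hU, hF⟩ := hf
  have hG : ((takeFn ∘ fanoutFn (polyFn p ∘ fstF) (concatFn ∘ fanoutFn sndF (Kannan.zerosFn ∘ polyFn p ∘ fstF))) ∘
      fanoutFn fstF (post ∘ fanoutFn fstF (pick ∘ fanoutFn (pre ∘ fstF) sndF))) ∈ FP :=
    comp_mem_FP (padCutFn_mem_FP p) (fanoutFn_mem_FP fstF_mem_FP (comp_mem_FP hpost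
      (fanoutFn_mem_FP fstF_mem_FP (comp_mem_FP hpick
        (fanoutFn_mem_FP (comp_mem_FP hpre fstF_mem_FP) sndF_mem_FP)))))
  have hGval : ∀ x y,
      ((takeFn ∘ fanoutFn (polyFn p ∘ fstF) (concatFn ∘ fanoutFn sndF (Kannan.zerosFn ∘ polyFn p ∘ fstF))) ∘
        fanoutFn fstF (post ∘ fanoutFn fstF (pick ∘ fanoutFn (pre ∘ fstF) sndF))) (boolPair x y)
        = (post (boolPair x (pick (boolPair (pre x) y))) ++ List.replicate (p.eval x.length) false).take
            (p.eval x.length) := by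
    intro x y
    simp [Kannan.zerosFn_apply]
  refine (isQSolvable_classicalWrap_dep pre _ hpre hG hFfree hU (fun x => {y | f (pre x) <+: y})
    (fun x => hF (pre x))).mono fun x => ?_
  rintro z ⟨y, hy, hz⟩
  have hy' : f (pre x) <+: y := hy
  show (post (boolPair x (f (pre x))) ++ List.replicate (p.eval x.length) false).take (p.eval x.length) <+: z
  rwa [hGval, hread _ _ hy'] at hz

/-! ### (H5) The everywhere-canonical answer map of the factoring witness -/

/-- **(H5) Canonical factoring witness.** With `h`, `g` the `FP` programs of `stub_extract` /
`stub_assemble` and Shor's family (`factoring_mem_FBQP_holds`) run on `h x`, the total map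
`a x := (g ⟨x, factorCode ⟦h x⟧⟩ ++ 0^{|x|}) ↾ |x|` satisfies `|a x| = |x|`, `a (genPQ w) = ansPQ w`
(`gspec` and `|ansPQ w| = |genPQ w|` from `stub_canon`), and is written first with probability `≥ 2/3` on
EVERY input by one uniform oracle-free Clifford+T family ((H4) at `p := X`).
[cite: Shor1997, §5] -/
theorem canonical_factoring_witness :
    ∃ a : List Bool → List Bool, (∀ w, a (genPQ w) = ansPQ w) ∧
      (∀ x, (a x).length = (X : Polynomial ℕ).eval x.length) ∧
      ∃ F : QCircuitFamily cliffordT, F.IsOracleFree ∧ F.IsUniform ∧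
        ∀ x, 2 / 3 ≤ F.kernelProb 0 x {y | a x <+: y} := by
  obtain ⟨h, hh, hspec⟩ := stub_extract
  obtain ⟨g, hg, gspec⟩ := stub_assemble
  obtain ⟨pick, hpick, hread⟩ := factorCode_pick
  have hf : (fun u => factorCode (decodeNat u)) ∈ FBQP := factoring_mem_FBQP_holds
  obtain ⟨F, hFfree, hU, hF⟩ :=
    everywhereQ_of_mem_FBQP (f := fun u => factorCode (decodeNat u)) X hf hh hg hpick hread
  refine ⟨fun x => (g (boolPair x (factorCode (decodeNat (h x)))) ++
      List.replicate ((X : Polynomial ℕ).eval x.length) false).take ((X : Polynomial ℕ).eval x.length),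
    fun w => ?_, fun x => length_take_append_replicate _ _, F, hFfree, hU, hF⟩
  show (g (boolPair (genPQ w) (factorCode (decodeNat (h (genPQ w))))) ++
      List.replicate ((X : Polynomial ℕ).eval (genPQ w).length) false).take
        ((X : Polynomial ℕ).eval (genPQ w).length) = ansPQ w
  rw [hspec w, decode_encodeNat, gspec w _ List.prefix_rfl, eval_X]
  exact take_append_replicate_of_length_eq (length_ansPQ (stub_canon w).2.1 (stub_canon w).2.2)

/-! ### (H6) Assembly under the factoring assumption -/

/-- **(H6a) `FactoringAssumption → WbwCanonicalThesis`** (`gen := genPQ`, `ans := ansPQ`, `p := X`, the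
canonical witness of (H5), and (C) by (H2) with `pre := prePQ` via `stub_canon` and `isOneWay_genPQ`).
CONDITIONAL on the registered conjecture `Theorems/FactoringAssumption.lean`; everything else is proved.
[cite: Goldreich2001, §2.2.4.1, Thm. 2.3.2] -/
theorem canonicalThesis_of_factoringAssumption (hF : FactoringAssumption) : WbwCanonicalThesis := by
  obtain ⟨a, hag, hlen, hQ⟩ := canonical_factoring_witness
  refine ⟨genPQ, ansPQ, a, X, (isOneWay_genPQ hF).1, hag, hlen, hQ, ?_⟩
  intro A hA
  simpa [ansPQ] using clauseC_of_isOneWay (isOneWay_genPQ hF) (fun w => (stub_canon w).1)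
    (fun w => (stub_canon w).2.1) A hA

end OfFactoring

/-! ### The stub -/

/-- **Stub `stub_certified_of_factoring`** of line `certified-canonical-lift` (crux `PlLift`,
stmt-QuantumAdvantage-0250; registered signature `FactoringAssumption → WbwCertifiedThesis`): under the
average-case factoring assumption, certified planting exists — the factoring witness `(genPQ, ansPQ)` of the
sibling crux `WbwThesis` with the everywhere-canonical answer map of (H5) and the trivial certificate
`V ≡ true` ((H6a) followed by (H1)). Conditional on the named conjecture `FactoringAssumption` only;
benchmark / calibration grade (Shor-redundant by design). [cite: Goldreich2001, §2.2.4.1] [cite: Shor1997, §5] -/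
theorem stub_certified_of_factoring : FactoringAssumption → WbwCertifiedThesis :=
  fun hF => OfFactoring.certified_of_canonical (OfFactoring.canonicalThesis_of_factoringAssumption hF)

end Summit.QuantumAdvantage.QuantumAdvantage.Cruxes.PlLift.CertifiedCanonicalLift

end
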